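import Literature.NumberTheory.Automorphic.BrandtModuleDictionary
import Literature.NumberTheory.Automorphic.BrandtWeightSymmetry
import HarnessLib

/-!
# `brandtMatrix_weight_symm` for an Eichler package follows from the `n`-divisibility of
# sub-ideals of index `n²`

Topic `NumberTheory/Automorphic`; theorems only (no definition, no named fact, no instance).
The named fact `brandtMatrix_weight_symm` of `BrandtModule.lean` (Eichler 1973, II §6 Thm. 2
(17): `w_j B(n)_ij = w_i B(n)_ji` for the Brandt data of every Eichler package) is reduced here,
package by package, to the single arithmetic input of Eichler's proof isolated in
`BrandtWeightSymmetry.lean`: *every sub-ideal `α I ⊆ J` of index `n²` between invertible right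
`O`-ideals contains `n J`* (the integrality of the conjugate ideal, i.e. local principality of
invertible ideals, Voight Main Thm. 16.6.1 — not in the tree). The passage between the two Brandt
vocabularies is the dictionary of `BrandtModuleDictionary.lean` (class sets in bijection, weights
equal, matrices transposed).

* `EichlerPackage.weight_mul_T_symm_of_nsmul_le` — for an Eichler package `P` of level
  `(N⁺, N⁻)` satisfying the `n`-divisibility hypothesis for all pairs of invertible right
  `P.O`-ideals, `w_j B(n)_ij = w_i B(n)_ji` for all `n, i, j`;
* `brandtMatrix_weight_symm_of_forall_nsmul_le` — hence the named fact
  `brandtMatrix_weight_symm`, granted that hypothesis for every package.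

## References

* M. Eichler, LNM 320 (1973), Ch. II §6 Thm. 2 eq. (17), (21)–(22) [Eichler1973].
* J. Voight, *Quaternion Algebras*, GTM 288 (2021), Main Thm. 16.6.1 [Voight2021].
-/

noncomputable section

open scoped Pointwise

namespace Literature.NumberTheory.Automorphic

variable {Nplus Nminus : ℕ}

/-- **Weight symmetry of the Brandt data of an Eichler package from `n`-divisibility.** If for
all invertible right `P.O`-ideals `I, J` (in the sense of `Brandt.rightIdeals`), every translate
`α I ⊆ J` of index `n²` contains `n J`, then `w_j B(n)_ij = w_i B(n)_ji` for the Brandt data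
`P.brandtData = (Cls O, w, B(·))` (`Brandt.weight_mul_matrix_symm_of_nsmul_le` transported along
`Brandt.ClassSet.equivRightIdealClass`). [cite: Eichler1973, Ch. II §6 Thm. 2 eq. (17)] -/
theorem EichlerPackage.weight_mul_T_symm_of_nsmul_le (P : EichlerPackage Nplus Nminus)
    (hstar : ∀ I ∈ Brandt.rightIdeals P.O, ∀ J ∈ Brandt.rightIdeals P.O, ∀ (α : P.Bˣ) (n : ℕ),
      α • I ≤ J → (α • I).toAddSubgroup.relIndex J.toAddSubgroup = n ^ 2 →
        ∀ y ∈ J, (n : ℤ) • y ∈ α • I)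
    (n : ℕ) (i j : P.brandtData.ι) :
    (P.brandtData.w j : ℤ) * P.brandtData.T n i j = (P.brandtData.w i : ℤ) * P.brandtData.T n j i := by
  have hO : IsZOrder P.O := P.isEichlerOrder.isZOrder
  have h : Brandt.rightIdeals P.O = invertibleRightIdeals P.O :=
    rightIdeals_eq_invertibleRightIdeals_of_isTotallyDefinite P.isTotallyDefinite hO
  set e := Brandt.ClassSet.equivRightIdealClass h with he
  obtain ⟨i', rfl⟩ := e.surjective i
  obtain ⟨j', rfl⟩ := e.surjective j
  have hw : ∀ k, P.brandtData.w (e k) = Brandt.weight P.O k := fun k =>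
    BrandtData.ofOrder_w_equivRightIdealClass hO h k
  have hT : ∀ k l, P.brandtData.T n (e k) (e l) = Brandt.matrix P.O n l k := fun k l =>
    BrandtData.ofOrder_T_equivRightIdealClass hO h n k l
  rw [hw, hw, hT, hT]
  exact (Brandt.weight_mul_matrix_symm_of_nsmul_le P.O n j' i'
    (fun α hle hidx => hstar _ j'.rep_mem _ i'.rep_mem α n hle hidx)
    (fun β hle hidx => hstar _ i'.rep_mem _ j'.rep_mem β n hle hidx))

/-- **The named fact `brandtMatrix_weight_symm` of `BrandtModule.lean` follows from the
`n`-divisibility of sub-ideals of index `n²`** (for the invertible right ideals of the Eichler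
order of every package) — the reduction of Eichler 1973 II §6 Thm. 2 (17) to its local input. [cite: Eichler1973, Ch. II §6 Thm. 2 eq. (17)] -/
theorem brandtMatrix_weight_symm_of_forall_nsmul_le
    (hstar : ∀ (Nplus Nminus : ℕ) (P : EichlerPackage Nplus Nminus),
      ∀ I ∈ Brandt.rightIdeals P.O, ∀ J ∈ Brandt.rightIdeals P.O, ∀ (α : P.Bˣ) (n : ℕ),
        α • I ≤ J → (α • I).toAddSubgroup.relIndex J.toAddSubgroup = n ^ 2 →
          ∀ y ∈ J, (n : ℤ) • y ∈ α • I) :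
    brandtMatrix_weight_symm := fun Nplus Nminus P n i j =>
  P.weight_mul_T_symm_of_nsmul_le (hstar Nplus Nminus P) n i j

end Literature.NumberTheory.Automorphic

end
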